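import Summits.Ventures.HodgeRepro2.T5SU11ResolventOrigin
import Summits.Ventures.HodgeRepro2.T5SU11KernelCornerSingularity

/-!
# The Neumann condition at the origin: `(G^I_λ g)′(t) → 0` as `t → 0⁺`

The derivative `(G^I_λ g)′ = −χ_λ′ B^I − φ_λ′ A^I` (row 492) tends to `0` at the origin: `φ_λ′(t) → φ_λ′(0) = 0` while `A^I` converges
(row 625), and `χ_λ′ B^I → 0` because `χ_λ′ = J φ_λ′ − φ_λ′ I − 1/(sinh 2t φ_λ)` (rows 443/447) against the SECOND-order
smallness `|B^I(t)| ≤ 2Φ M cosh 2 · t²` of the inner integral: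

* `abs_greenBI_le_sq` — **`|B^I(t)| ≤ 2 Φ M cosh 2 · t²`** for `0 < t ≤ 1` (`sinh 2s ≤ 2s cosh 2`);
* `abs_roIntegral_le_of_le_one` — `|I(t)| ≤ (−log t)/(2m)` for `0 < t ≤ 1`;
* `tendsto_deriv_sph_hyp_nhdsGT_zero` — `φ_λ′(t) → 0` as `t → 0⁺`;
* `tendsto_sphDecay'_mul_greenBI` — **`χ_λ′(t) B^I(t) → 0`** as `t → 0⁺`;
* `tendsto_greenSolI'_nhdsGT_zero` — **THE NEUMANN CONDITION: `(G^I_λ g)′(t) → 0` as `t → 0⁺`** for every source bounded on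
  `(0, 1]` and integrable against the basis;
* `tendsto_deriv_kernel_comp_nhdsGT_zero` — **`∂_t K_λ^{∘(n+2)}(t, s) → 0` as `t → 0⁺`**: every composed kernel satisfies the
  Neumann condition at the origin (row 625 gave it for the kernel itself).

Nothing is claimed about (N).

Blind lane: Mathlib + the HodgeRepro2 prefix only; no sorry; axioms ⊆ {propext, Classical.choice,
Quot.sound}.
-/

namespace Summit.Ventures.HodgeRepro2.T5SU11ResolventNeumannOrigin

open Filter Topology MeasureTheory
open Set (Ioi Ioc Icc)
open T5SU11Cartan T5SU11SphericalFunction T5SU11SphericalBounds T5SU11SphericalContinuous T5SU11SphericalDecay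
  T5SU11SphericalSolutionSpaceAll T5SU11SphericalDeriv T5SU11ReductionOfOrder T5SU11ReductionOfOrderInfinity
  T5SU11ReductionOfOrderOrigin T5SU11RadialGreenKernel T5SU11RadialGreenImproper T5SU11RadialGreenImproperOrigin
  T5SU11KernelCompositionODE T5SU11KernelCornerSingularity T5SU11ResolventOrigin

section measure

variable [MeasurableSpace Circle] [BorelSpace Circle]

variable {lam : ℝ} (hlam : 1 < lam) {g : ℝ → ℝ} (hg : ContinuousOn g (Ioi 0))
  {M : ℝ} (hM : ∀ s ∈ Ioc (0 : ℝ) 1, |g s| ≤ M) (hM0 : 0 ≤ M)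
  (hB : ∀ T, IntegrableOn (fun s => sph lam (hyp s) * g s * Real.sinh (2 * s)) (Ioc 0 T))
  (hA : IntegrableOn (fun s => sphDecay lam s * g s * Real.sinh (2 * s)) (Ioi 0))

include hM hM0 in
/-- **`|B^I(t)| ≤ 2 Φ M cosh 2 · t²`** for `0 < t ≤ 1`, where `φ_λ ≤ Φ` on `[0, 1]` and `|g| ≤ M` on `(0, 1]`. -/
theorem abs_greenBI_le_sq {Φ : ℝ} (hΦ : ∀ s ∈ Icc (0 : ℝ) 1, sph lam (hyp s) ≤ Φ) (hΦ0 : 0 ≤ Φ)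
    {t : ℝ} (ht : 0 < t) (ht1 : t ≤ 1) :
    |greenBI (fun t => sph lam (hyp t)) g t| ≤ 2 * Φ * M * Real.cosh 2 * t ^ 2 := by
  unfold greenBI
  have h := norm_setIntegral_le_of_norm_le_const (μ := volume) (s := Ioc 0 t)
    (f := fun s => sph lam (hyp s) * g s * Real.sinh (2 * s)) (C := Φ * M * (2 * t * Real.cosh 2))
    (by rw [Real.volume_Ioc]; exact ENNReal.ofReal_lt_top) (fun s hs => ?_)
  · rw [Real.norm_eq_abs, Real.volume_real_Ioc_of_le ht.le, sub_zero] at h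
    calc _ ≤ Φ * M * (2 * t * Real.cosh 2) * t := h
      _ = 2 * Φ * M * Real.cosh 2 * t ^ 2 := by ring
  · have hs0 : 0 < s := hs.1
    rw [Real.norm_eq_abs, abs_mul, abs_mul, abs_of_pos (sph_hyp_pos lam s),
      abs_of_nonneg (Real.sinh_nonneg_iff.mpr (by linarith))]
    have h1 : sph lam (hyp s) ≤ Φ := hΦ s ⟨hs0.le, le_trans hs.2 ht1⟩
    have h2 : |g s| ≤ M := hM s ⟨hs0, le_trans hs.2 ht1⟩
    have h3 : Real.sinh (2 * s) ≤ 2 * t * Real.cosh 2 := by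
      calc Real.sinh (2 * s) ≤ 2 * s * Real.cosh 2 := sinh_two_mul_le_of_le_one hs0.le (le_trans hs.2 ht1)
        _ ≤ 2 * t * Real.cosh 2 := by
            have := Real.cosh_pos 2
            nlinarith [hs.2]
    exact mul_le_mul (mul_le_mul h1 h2 (abs_nonneg _) hΦ0) h3
      (Real.sinh_nonneg_iff.mpr (by linarith)) (mul_nonneg hΦ0 hM0)

include hlam in
/-- **`|I(t)| ≤ (−log t)/(2m)`** for `0 < t ≤ 1`, where `m ≤ φ_λ²` on `[0, 1]` (the reduction-of-order integral `I = ∫_1^t`). -/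
theorem abs_roIntegral_le_of_le_one {m : ℝ} (hm : 0 < m) (hmin : ∀ s ∈ Icc (0 : ℝ) 1, m ≤ sph lam (hyp s) ^ 2)
    {t : ℝ} (ht : 0 < t) (ht1 : t ≤ 1) :
    |roIntegral (fun t => sph lam (hyp t)) t| ≤ (-Real.log t) / (2 * m) := by
  have hT := tailIntegral_le_of_le_one hlam hm hmin ht ht1
  have hint := integrableOn_roIntegrand_sph hlam
  have e1 := tailIntegral_eq (hφ_sph lam) (hpos_sph lam) hint ht
  have e2 := tailIntegral_eq (hφ_sph lam) (hpos_sph lam) hint one_pos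
  rw [roIntegral_one] at e2
  -- `I(t) ≤ 0` and `−I(t) = T(t) − T(1) ≤ (−log t)/(2m)`
  have hI0 : roIntegral (fun t => sph lam (hyp t)) t ≤ 0 := by
    rcases lt_or_eq_of_le ht1 with h | h
    · exact (roIntegral_neg (hφ_sph lam) (hpos_sph lam) ht h).le
    · rw [h, roIntegral_one]
  rw [abs_of_nonpos hI0]
  linarith

/-- `φ_λ′(t) → 0` as `t → 0⁺` (`φ_λ′` is continuous and `φ_λ′(0) = 0`). -/
theorem tendsto_deriv_sph_hyp_nhdsGT_zero (lam : ℝ) :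
    Tendsto (deriv fun t => sph lam (hyp t)) (𝓝[>] 0) (𝓝 0) := by
  have h := (hasDerivAt_deriv_sph_hyp lam 0).continuousAt.tendsto.mono_left (nhdsWithin_le_nhds (s := Ioi 0))
  rwa [deriv_sph_hyp_zero] at h

include hlam hM hM0 in
/-- **`χ_λ′(t) B^I(t) → 0` as `t → 0⁺`**: `χ_λ′ = J φ_λ′ − φ_λ′ I − 1/(sinh 2t · φ_λ)` against `|B^I| ≤ C t²`. -/
theorem tendsto_sphDecay'_mul_greenBI :
    Tendsto (fun t => sphDecay' lam t * greenBI (fun t => sph lam (hyp t)) g t) (𝓝[>] 0) (𝓝 0) := by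
  obtain ⟨m, hm, hmin⟩ := exists_sph_hyp_sq_ge lam
  obtain ⟨Φ, hΦ, hΦle⟩ := exists_sph_hyp_le lam
  obtain ⟨m₀, M₀, hm₀, hm₀le, _⟩ := exists_sph_hyp_bounds_Ioc lam
  set J := ∫ s in Ioi 1, roIntegrand (fun t => sph lam (hyp t)) s with hJ
  set C₂ := 2 * Φ * M * Real.cosh 2 with hC₂
  have hC₂0 : 0 ≤ C₂ := by positivity
  have hJ0 : 0 ≤ J := roIntegral_tail_nonneg lam
  -- the three pieces of the bound tend to `0`
  have hlim : Tendsto (fun t => J * C₂ * t ^ 2 + C₂ / (2 * m) * (-(Real.log t * t) * t) + C₂ / (2 * m₀) * t)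
      (𝓝[>] 0) (𝓝 0) := by
    have h1 : Tendsto (fun t : ℝ => t) (𝓝[>] 0) (𝓝 0) := tendsto_id.mono_left nhdsWithin_le_nhds
    have h2 : Tendsto (fun t : ℝ => Real.log t * t) (𝓝[>] 0) (𝓝 0) := by
      have := tendsto_log_mul_rpow_nhdsGT_zero one_pos
      simpa only [Real.rpow_one] using this
    have := (((h1.pow 2).const_mul (J * C₂)).add (((h2.neg).mul h1).const_mul (C₂ / (2 * m)))).add
      (h1.const_mul (C₂ / (2 * m₀)))
    simpa using this
  have hφ' := tendsto_deriv_sph_hyp_nhdsGT_zero lam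
  refine squeeze_zero_norm' ?_ hlim
  filter_upwards [Ioo_mem_nhdsGT one_pos, hφ'.eventually (eventually_abs_sub_lt 0 one_pos)] with t ht hφ'1
  rw [sub_zero] at hφ'1
  have hBle := abs_greenBI_le_sq hM hM0 hΦle hΦ.le ht.1 ht.2.le
  have hIle := abs_roIntegral_le_of_le_one hlam hm hmin ht.1 ht.2.le
  have hlog : 0 ≤ -Real.log t := neg_nonneg.mpr (Real.log_nonpos ht.1.le ht.2.le)
  have hsinh : 2 * t ≤ Real.sinh (2 * t) := Real.self_le_sinh_iff.mpr (by linarith [ht.1])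
  have hφm : m₀ ≤ sph lam (hyp t) := hm₀le t ht.1 ht.2.le
  have hφpos : 0 < sph lam (hyp t) := sph_hyp_pos lam t
  -- `χ′ = J φ′ − (φ′ I + (sinh 2t φ)⁻¹)`
  have hχ' : sphDecay' lam t = J * deriv (fun t => sph lam (hyp t)) t
      - (deriv (fun t => sph lam (hyp t)) t * roIntegral (fun t => sph lam (hyp t)) t
        + (Real.sinh (2 * t) * sph lam (hyp t))⁻¹) := rfl
  rw [Real.norm_eq_abs, hχ']
  have hsp : 0 < Real.sinh (2 * t) * sph lam (hyp t) :=
    mul_pos (sinh_two_mul_pos ht.1) hφpos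
  -- bound the three terms
  have hB0 : 0 ≤ |greenBI (fun t => sph lam (hyp t)) g t| := abs_nonneg _
  have hterm1 : |J * deriv (fun t => sph lam (hyp t)) t * greenBI (fun t => sph lam (hyp t)) g t|
      ≤ J * C₂ * t ^ 2 := by
    rw [abs_mul, abs_mul, abs_of_nonneg hJ0]
    calc J * |deriv (fun t => sph lam (hyp t)) t| * |greenBI (fun t => sph lam (hyp t)) g t|
        ≤ J * 1 * (C₂ * t ^ 2) :=
          mul_le_mul (mul_le_mul_of_nonneg_left hφ'1.le hJ0) hBle hB0 (by positivity)
      _ = J * C₂ * t ^ 2 := by ring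
  have hterm2 : |deriv (fun t => sph lam (hyp t)) t * roIntegral (fun t => sph lam (hyp t)) t
      * greenBI (fun t => sph lam (hyp t)) g t| ≤ C₂ / (2 * m) * (-(Real.log t * t) * t) := by
    rw [abs_mul, abs_mul]
    calc |deriv (fun t => sph lam (hyp t)) t| * |roIntegral (fun t => sph lam (hyp t)) t|
          * |greenBI (fun t => sph lam (hyp t)) g t|
        ≤ 1 * ((-Real.log t) / (2 * m)) * (C₂ * t ^ 2) :=
          mul_le_mul (mul_le_mul hφ'1.le hIle (abs_nonneg _) zero_le_one) hBle hB0 (by positivity)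
      _ = C₂ / (2 * m) * (-(Real.log t * t) * t) := by
          field_simp
  have hterm3 : |(Real.sinh (2 * t) * sph lam (hyp t))⁻¹ * greenBI (fun t => sph lam (hyp t)) g t|
      ≤ C₂ / (2 * m₀) * t := by
    rw [abs_mul, abs_inv, abs_of_pos hsp]
    have hden : 2 * t * m₀ ≤ Real.sinh (2 * t) * sph lam (hyp t) :=
      mul_le_mul hsinh hφm hm₀.le (sinh_two_mul_pos ht.1).le
    have h2tm : 0 < 2 * t * m₀ := by
      have := ht.1
      positivity
    calc (Real.sinh (2 * t) * sph lam (hyp t))⁻¹ * |greenBI (fun t => sph lam (hyp t)) g t|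
        ≤ (2 * t * m₀)⁻¹ * (C₂ * t ^ 2) :=
          mul_le_mul (inv_anti₀ h2tm hden) hBle hB0 (inv_nonneg.mpr h2tm.le)
      _ = C₂ / (2 * m₀) * t := by
          field_simp
  calc |(J * deriv (fun t => sph lam (hyp t)) t
        - (deriv (fun t => sph lam (hyp t)) t * roIntegral (fun t => sph lam (hyp t)) t
          + (Real.sinh (2 * t) * sph lam (hyp t))⁻¹)) * greenBI (fun t => sph lam (hyp t)) g t|
      = |J * deriv (fun t => sph lam (hyp t)) t * greenBI (fun t => sph lam (hyp t)) g t
        - deriv (fun t => sph lam (hyp t)) t * roIntegral (fun t => sph lam (hyp t)) t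
          * greenBI (fun t => sph lam (hyp t)) g t
        - (Real.sinh (2 * t) * sph lam (hyp t))⁻¹ * greenBI (fun t => sph lam (hyp t)) g t| := by
        congr 1
        ring
    _ ≤ |J * deriv (fun t => sph lam (hyp t)) t * greenBI (fun t => sph lam (hyp t)) g t|
        + |deriv (fun t => sph lam (hyp t)) t * roIntegral (fun t => sph lam (hyp t)) t
          * greenBI (fun t => sph lam (hyp t)) g t|
        + |(Real.sinh (2 * t) * sph lam (hyp t))⁻¹ * greenBI (fun t => sph lam (hyp t)) g t| := by
        exact le_trans (abs_sub _ _) (add_le_add_left (abs_sub _ _) _)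
    _ ≤ J * C₂ * t ^ 2 + C₂ / (2 * m) * (-(Real.log t * t) * t) + C₂ / (2 * m₀) * t :=
        add_le_add (add_le_add hterm1 hterm2) hterm3

include hlam hM hM0 hA in
/-- **THE NEUMANN CONDITION AT THE ORIGIN**: `(G^I_λ g)′(t) = −χ_λ′ B^I − φ_λ′ A^I → 0` as `t → 0⁺`. -/
theorem tendsto_greenSolI'_nhdsGT_zero :
    Tendsto (greenSolI' (deriv fun t => sph lam (hyp t)) (sphDecay' lam) (fun t => sph lam (hyp t)) (sphDecay lam) g)
      (𝓝[>] 0) (𝓝 0) := by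
  have h1 := tendsto_sphDecay'_mul_greenBI hlam hM hM0 (g := g)
  have h2 := (tendsto_deriv_sph_hyp_nhdsGT_zero lam).mul (tendsto_greenAI_nhdsGT_zero hA)
  rw [zero_mul] at h2
  have h := (h1.neg).sub h2
  rw [neg_zero, sub_zero] at h
  exact h

include hlam in
/-- **Every composed kernel satisfies the Neumann condition at the origin**: `∂_t K_λ^{∘(n+2)}(t, s) → 0` as `t → 0⁺`. -/
theorem tendsto_deriv_kernel_comp_nhdsGT_zero {s : ℝ} (hs : 0 < s) (n : ℕ) :
    Tendsto (greenSolI' (deriv fun t => sph lam (hyp t)) (sphDecay' lam) (fun t => sph lam (hyp t)) (sphDecay lam)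
        ((greenSolI (fun t => sph lam (hyp t)) (sphDecay lam))^[n] (fun r => sphGreenKernel lam r s)))
      (𝓝[>] 0) (𝓝 0) := by
  obtain ⟨_, _, hA⟩ := kernel_comp_basis_integrable hlam hs n
  obtain ⟨Ms, hMs0, hMs⟩ := T5SU11KernelDifferenceRegularity.kernel_source_bounded hlam hs
  obtain ⟨Cs, s₀, hCs⟩ := T5SU11KernelDifferenceRegularity.kernel_source_decay hlam hs
  have hks := T5SU11KernelDifferenceRegularity.kernel_source_continuousOn hlam hs
  have hεk : 2 - lam < lam := by linarith
  obtain ⟨_, ⟨Mn, hMn0, hMn⟩, _⟩ :=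
    T5SU11ResolventNeumann.iterate_class (lam₂ := lam) hlam hks hMs hMs0 hεk hCs n
  exact tendsto_greenSolI'_nhdsGT_zero hlam hMn hMn0 hA

end measure

end Summit.Ventures.HodgeRepro2.T5SU11ResolventNeumannOrigin
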